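import Literature.Analysis.FluidPDE.NSLerayRegularisedLimitHolds
import Literature.Analysis.FluidPDE.CheskidovShvydkoyRegular
import HarnessLib

/-!
# Weak gradients of `L²` limits of `C¹` fields with bounded dissipation (lower semicontinuity)

Analysis/FluidPDE proof file (no named facts). If `C¹` fields `f n : E → E` converge in `L²(E)` to
`f` and their dissipations `∫ |∇f n|²` have finite inferior limit, then `f` has a weak gradient `G`
with the Fatou bound `∫ |G|² ≤ lim inf ∫ |∇f n|²` (`exists_hasWeakGradient_of_tendsto_eLpNorm`).
This is the tree's `IsLerayRegularisedScheme.exists_hasWeakGradient_slice`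
(`NSLerayRegularisedLimitHolds.lean`; Leray 1934, §29; Ożański–Pooley 2018, proof of Thm. 6.37,
Step 3, (6.101)–(6.103): "`∇u_{εₙₖ}(t) ⇀ ∇u(t)` … `‖∇u(t)‖ ≤ lim inf ‖∇u_{εₙ}(t)‖`") with the
regularised scheme abstracted away: only the strong `L²` convergence of the fields and the
`C¹`-smoothness of the approximants are used. The proof is the same (weak compactness of the
gradient tuples, `exists_subseq_weakLimit_of_sq_le`, and passage to the limit in the
integration-by-parts identities). It is the lower-semicontinuity tool of the approximation scheme in
the decomposition of `tao2011_H1_local_almost_regular` (weak gradients and dissipation of the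
limit solution; Robinson–Rodrigo–Sadowski 2016, Lemma A.20 / proof of Thm. 4.10).

## References

* W. S. Ożański, B. C. Pooley, LMS Lecture Notes 452, CUP 2018, proof of Thm. 6.37, Step 3,
  (6.101)–(6.103). [OzanskiPooley2018]
* J. C. Robinson, J. L. Rodrigo, W. Sadowski, CUP 2016, Lemma A.20. [RobinsonRodrigoSadowski2016]
-/

noncomputable section

open MeasureTheory TopologicalSpace Set Function Filter Topology ContinuousLinearMap
open scoped InnerProductSpace RealInnerProductSpace ENNReal NNReal

namespace Literature.Analysis.FluidPDE

variable {E : Type*} [NormedAddCommGroup E] [InnerProductSpace ℝ E] [FiniteDimensional ℝ E]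
  [MeasurableSpace E] [BorelSpace E]

/-- **Weak gradient of an `L²` limit with the Fatou bound** (Ożański–Pooley 2018, proof of
Thm. 6.37, Step 3, (6.101)–(6.103); Robinson–Rodrigo–Sadowski 2016, Lemma A.20). Let `f n : E → E`
be `C¹` fields in `L²` converging in `L²` to `f ∈ L²`, with
`lim inf ∫ |∇f n|² < ∞`. Then `f` has a weak gradient `G` with `∫ |G|² ≤ lim inf ∫ |∇f n|²`:
along a subsequence almost attaining the inferior limit the gradient tuples converge weakly in
`L²(E; E^d)` to some `g` with `‖g‖₂² ≤ lim inf` (`exists_subseq_weakLimit_of_sq_le`), `G = T g`,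
and the integration-by-parts identities of the `C¹` fields pass to the limit. [cite: OzanskiPooley2018, proof of Thm. 6.37 Step 3 (6.101)–(6.103)] -/
theorem exists_hasWeakGradient_of_tendsto_eLpNorm {f : ℕ → E → E} {fl : E → E}
    (hf1 : ∀ n, ContDiff ℝ 1 (f n)) (hf2 : ∀ n, MemLp (f n) 2 volume) (hfl : MemLp fl 2 volume)
    (hstrong : Tendsto (fun n => eLpNorm (f n - fl) 2 volume) atTop (𝓝 0))
    (hlim : liminf (fun n => ∫⁻ x, ENNReal.ofReal (FluidPDE.frobeniusNormSq (fderiv ℝ (f n) x))) atTop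
      < ∞) :
    ∃ G : E → E →L[ℝ] E, FluidPDE.HasWeakGradient fl G ∧
      ∫⁻ x, ENNReal.ofReal (FluidPDE.frobeniusNormSq (G x)) ≤
        liminf (fun n => ∫⁻ x, ENNReal.ofReal (FluidPDE.frobeniusNormSq (fderiv ℝ (f n) x))) atTop := by
  set F : ℕ → ℝ≥0∞ := fun n => ∫⁻ x, ENNReal.ofReal (FluidPDE.frobeniusNormSq (fderiv ℝ (f n) x)) with hF
  set L : ℝ≥0∞ := liminf F atTop with hLdef
  have hLtop : L ≠ ∞ := hlim.ne
  -- Step A: a subsequence almost attaining the inferior limit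
  have hfreq : ∀ k : ℕ, ∃ᶠ n in atTop, F n < L + ((k : ℝ≥0∞) + 1)⁻¹ := fun k =>
    frequently_lt_of_liminf_lt (by isBoundedDefault)
      (ENNReal.lt_add_right hLtop (ENNReal.inv_ne_zero.2 (by simp)))
  obtain ⟨κ₁, hκ₁, hFκ⟩ := extraction_forall_of_frequently hfreq
  -- Step B: the gradient tuples and their bounds
  have hfin : ∀ k, F (κ₁ k) < ∞ := fun k =>
    (hFκ k).trans (ENNReal.add_lt_top.2 ⟨hlim, ENNReal.inv_lt_top.2 (by positivity)⟩)
  set w : ℕ → E → GradTuple E := fun k => gradTuple (f (κ₁ k)) with hw_def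
  have hw : ∀ k, MemLp (w k) 2 (volume : Measure E) := fun k =>
    memLp_gradTuple (hf1 (κ₁ k)) (hfin k)
  have hb : ∀ k, ‖(hw k).toLp (w k)‖ ^ 2 ≤ L.toReal + 1 / ((k : ℝ) + 1) := fun k => by
    rw [Lp.norm_toLp, ← ENNReal.toReal_pow, eLpNorm_gradTuple_sq]
    have h1 : F (κ₁ k) ≤ L + ((k : ℝ≥0∞) + 1)⁻¹ := (hFκ k).le
    have h2 : (L + ((k : ℝ≥0∞) + 1)⁻¹).toReal = L.toReal + 1 / ((k : ℝ) + 1) := by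
      rw [ENNReal.toReal_add hLtop (ENNReal.inv_ne_top.2 (by positivity)), ENNReal.toReal_inv, one_div]
      norm_cast
    rw [← h2]
    exact ENNReal.toReal_mono (ENNReal.add_ne_top.2 ⟨hLtop, ENNReal.inv_ne_top.2 (by positivity)⟩) h1
  -- Step C: the weak limit of the tuples
  obtain ⟨κ₂, g, hg, hκ₂, hgL, hweak⟩ := exists_subseq_weakLimit_of_sq_le hw ENNReal.toReal_nonneg hb
  -- Step D: the weak gradient and its dissipation
  refine ⟨tupleToCLM g, ?_, ?_⟩
  swap
  · rw [lintegral_frobeniusNormSq_tupleToCLM]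
    have h1 : eLpNorm g 2 (volume : Measure E) = ENNReal.ofReal ‖hg.toLp g‖ := by
      rw [Lp.norm_toLp, ENNReal.ofReal_toReal hg.eLpNorm_ne_top]
    rw [h1, ← ENNReal.ofReal_pow (norm_nonneg _), ← ENNReal.ofReal_toReal hLtop]
    exact ENNReal.ofReal_le_ofReal hgL
  -- Step E: the integration-by-parts identity in the limit
  set κ : ℕ → ℕ := fun k => κ₁ (κ₂ k) with hκ_def
  have hκ : StrictMono κ := hκ₁.comp hκ₂
  have hUk : ∀ k, MemLp (f (κ k)) 2 volume := fun k => hf2 (κ k)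
  have hG2 : MemLp (tupleToCLM g) 2 (volume : Measure E) := memLp_tupleToCLM hg
  refine ⟨(hfl.locallyIntegrable one_le_two).locallyIntegrableOn _,
    (hG2.locallyIntegrable one_le_two).locallyIntegrableOn _, fun θ v hθ => ?_⟩
  simp only [TopologicalSpace.Opens.coe_top, Measure.restrict_univ]
  -- integrability facts
  have hθ2 : MemLp θ 2 (volume : Measure E) := memLp_of_isTestFunctionOn_real hθ 2
  have hdθ2 : MemLp (fun x => fderiv ℝ θ x v) 2 (volume : Measure E) :=
    memLp_fderiv_apply_of_isTestFunctionOn_real hθ v 2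
  have iL : Integrable (fun x => (fderiv ℝ θ x v) • fl x) volume := integrable_smul_of_memLp_two hdθ2 hfl
  have iR : Integrable (fun x => θ x • tupleToCLM g x v) volume :=
    integrable_smul_of_memLp_two hθ2 (memLp_clm_apply hG2 v)
  -- reduce to inner products with a fixed vector `c`
  refine ext_inner_left ℝ fun c => ?_
  rw [inner_neg_right, ← integral_inner iL c, ← integral_inner iR c]
  -- the identities of the approximations
  have hidk : ∀ k, ∫ x, ⟪c, (fderiv ℝ θ x v) • f (κ k) x⟫ =
      -∫ x, ⟪w (κ₂ k) x, testTuple θ v c x⟫ := by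
    intro k
    have hk := (hasWeakGradient_fderiv_of_contDiff (hf1 (κ k))).integral_fderiv_smul_eq θ v hθ
    simp only [TopologicalSpace.Opens.coe_top, Measure.restrict_univ] at hk
    have iLk : Integrable (fun x => (fderiv ℝ θ x v) • f (κ k) x) volume :=
      integrable_smul_of_memLp_two hdθ2 (hUk k)
    have hcont : Continuous fun x => fderiv ℝ (f (κ k)) x v :=
      ((hf1 (κ k)).continuous_fderiv one_ne_zero).clm_apply continuous_const
    have iRk : Integrable (fun x => θ x • fderiv ℝ (f (κ k)) x v) volume :=
      (hθ.contDiff.continuous.smul hcont).integrable_of_hasCompactSupport hθ.hasCompactSupport.smul_right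
    rw [integral_inner iLk c, hk, inner_neg_right, ← integral_inner iRk c]
    congr 1
    refine integral_congr_ae (Eventually.of_forall fun x => ?_)
    show ⟪c, θ x • fderiv ℝ (f (κ k)) x v⟫ = ⟪w (κ₂ k) x, testTuple θ v c x⟫
    rw [hw_def]
    simp only
    rw [← tupleToCLM_gradTuple_apply, real_inner_smul_right, real_inner_comm, ← real_inner_smul_right,
      inner_tupleToCLM_apply_smul]
  -- pass to the limit on both sides
  have hsw : ∀ (y : E → E) (x : E), ⟪c, (fderiv ℝ θ x v) • y x⟫ = ⟪y x, (fderiv ℝ θ x v) • c⟫ := fun y x => by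
    rw [real_inner_smul_right, real_inner_comm, ← real_inner_smul_right]
  have hz : MemLp (fun x => (fderiv ℝ θ x v) • c) 2 (volume : Measure E) :=
    (((hθ.contDiff.continuous_fderiv (by simp)).clm_apply continuous_const).smul continuous_const)
      |>.memLp_of_hasCompactSupport ((hθ.hasCompactSupport.fderiv_apply (𝕜 := ℝ) v).smul_right)
  have hlhs : Tendsto (fun k => ∫ x, ⟪c, (fderiv ℝ θ x v) • f (κ k) x⟫) atTop
      (𝓝 (∫ x, ⟪c, (fderiv ℝ θ x v) • fl x⟫)) := by
    have h := tendsto_integral_inner_of_tendsto_eLpNorm hUk hfl hz (hstrong.comp hκ.tendsto_atTop)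
    simp_rw [hsw]
    exact h
  have hrhs : Tendsto (fun k => -∫ x, ⟪w (κ₂ k) x, testTuple θ v c x⟫) atTop
      (𝓝 (-∫ x, ⟪g x, testTuple θ v c x⟫)) := (hweak _ (memLp_testTuple hθ v c)).neg
  have hA := tendsto_nhds_unique hlhs (hrhs.congr fun k => (hidk k).symm)
  rw [hA]
  congr 1
  refine integral_congr_ae (Eventually.of_forall fun x => ?_)
  show ⟪g x, testTuple θ v c x⟫ = ⟪c, θ x • tupleToCLM g x v⟫
  rw [real_inner_smul_right, ← real_inner_comm c (tupleToCLM g x v), ← real_inner_smul_right,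
    inner_tupleToCLM_apply_smul]

/-- **Lower semicontinuity of the weak dissipation under `L²` convergence**: with the hypotheses
of `exists_hasWeakGradient_of_tendsto_eLpNorm`, `∫⁻ |∇f|² ≤ lim inf ∫ |∇f n|²` for the weak
dissipation functional `eWeakGradL2Sq` of the limit. [folklore] -/
theorem eWeakGradL2Sq_le_liminf_of_tendsto_eLpNorm {f : ℕ → E → E} {fl : E → E}
    (hf1 : ∀ n, ContDiff ℝ 1 (f n)) (hf2 : ∀ n, MemLp (f n) 2 volume) (hfl : MemLp fl 2 volume)
    (hstrong : Tendsto (fun n => eLpNorm (f n - fl) 2 volume) atTop (𝓝 0))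
    (hlim : liminf (fun n => ∫⁻ x, ENNReal.ofReal (FluidPDE.frobeniusNormSq (fderiv ℝ (f n) x))) atTop
      < ∞) :
    eWeakGradL2Sq fl ≤
      liminf (fun n => ∫⁻ x, ENNReal.ofReal (FluidPDE.frobeniusNormSq (fderiv ℝ (f n) x))) atTop := by
  obtain ⟨G, hG, hle⟩ := exists_hasWeakGradient_of_tendsto_eLpNorm hf1 hf2 hfl hstrong hlim
  exact (eWeakGradL2Sq_le_of_hasWeakGradient hG).trans hle

end Literature.Analysis.FluidPDE

end
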